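import Summits.BirchSwinnertonDyer.BirchSwinnertonDyer.Theorems.ClassRecordThreeHalvesAtThreeNormContinuity
import HarnessLib

/-!
# Route `ClassRecordThree`, crux `ValueContinuityAtThree` (item stmt-BirchSwinnertonDyer-19493; the shared H2 child
# of `HalvesAtThree` 19107 and of KolyvaginRoadThree's `HalvesTamAtThree` 19155) — BY-NAME SUPPLIERS and the
# registered BC3 stubs: the crux ⟸ THEOREM C typed; the crux ⟸ (VN₃) ∧ frames; the crux ⟹ (VN₃) ∧ the H2 leaf;
# each registered stub ⟸ THEOREM C typed on its sign; the sign split is lossless (crux ⟺ stub (a) ∧ stub (b))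

Cell `bsd-stepL` (run/shared/lean/pub/bsd-stepL/), seat `bsd-stepL-thmc-p1` (prover g4, D-0074 hands, 2026-08-26),
`--supports stmt-BirchSwinnertonDyer-19493`. The crux decl `Theses.ClassRecordThree.ValueContinuityAtThree` (planner
g24, route rev 7) is VERBATIM the hypothesis `hVC` (quantified over every curve) of this seat's landed theorems
(`Theorems/ClassRecordThreeHalvesAtThreeValueContinuity.lean`, g2; `…NormContinuity.lean`, `…Leaves.lean`, g3), so
every arrow below is a one-line composition of landed theorems read AGAINST THE CRUX DECL BY NAME; the planner's BC3
skeleton (`Cruxes/…/plan/bc3/ValueContinuityAtThree_birth.lean`, registered 2026-08-26T09:00Z) cuts the crux by the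
sign `a₃(E) = ±1` into `stub_vc3_split` ∕ `stub_vc3_nonsplit`, whose signatures are restated here verbatim.

## What this file records in the kernel (all implications or equivalences; nothing discharged)

1. `classRecordThree_valueContinuityAtThree_of_classicalFrameValue`: THEOREM C typed for every curve (g0's `hC` =
   `h12` of `Three.bdpValueAt₃_of_frameValue` ∀ W: ONE `R₀`-integral frame with Castella's interpolation property AND
   the value `u·((1 − a₃·3⁻¹)·log_{ω_E} P)²` at `𝟙`, at every X11b@3 classical datum and every `ι'`) ⟹ the crux.
2. `classRecordThree_valueContinuityAtThree_of_normContinuity_of_frames`: (VN₃) for every curve (NORM continuity at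
   `𝟙`, the weakest H2 currency) ∧ (a frame exists at every datum and every `ι'`) ⟹ the crux. So modulo frame
   existence the crux, THEOREM C typed and (VN₃) are one statement (with 3).
3. `normContinuity₃_classwide_of_classRecordThree_valueContinuityAtThree` (crux ⟹ (VN₃) ∀ W),
   `bdpValueAt₃_of_classRecordThree_valueContinuityAtThree` (crux ⟹ `Three.BDPValueAt₃ W` ∀ W),
   `classRecordThree_bdpValueLeafAtThree_of_valueContinuityAtThree` (crux 19493 ⟹ aside leaf 19406 by name).
4. `classRecordThree_stub_vc3_split_of_classicalFrameValue` ∕ `…_nonsplit_…`: each REGISTERED stub follows from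
   THEOREM C typed restricted to its sign — a hand that kernel-proves THEOREM C for one sign closes that stub by name.
5. `classRecordThree_valueContinuityAtThree_iff_stubs`: crux ⟺ stub (a) ∧ stub (b) — the planner's case split at
   the sign of `a₃` loses nothing (the two stubs are the crux with one idle-free extra binder each).

READING (for the planner; see HOME/thmc/kernel-g4/READING.md): the two stubs are NOT served by different printed
engines — at weight 2 and `3 ∥ N` the value at `𝟙` carries the factor `(1 − a₃·3⁻¹) ∈ {2/3, 4/3}`, non-zero for both
signs (no exceptional zero at the BDP point; the exceptional zero of Castella's J. Inst. Math. Jussieu 17 (2018) paper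
is the vanishing of the big-Heegner-point specialisation `𝒵_{𝔭,f,0}`, not of `L_𝔭(f)(𝐍_K)`), and memo THEOREM C
(PROOF-BDP §20, referee PASS) proves both signs by one argument (a_p symbolic; for `a₃ = −1` the only sign-aware step
is LZZ18 App. A Prop. A.1 after an unramified quadratic base change). Printed coverage at `p = 3 ∣ N`: none in any
currency (BDP13 Assumption 5.12 (5) «p split in K and prime to Nc» — no `p ≥ 5`, so `3 ∤ N` is printed; Castella
JIMJ 2018 Thms. 2.10–2.11 remove «prime to N» under the paper-wide `p ≥ 5`; Kriz 2021 Thm. 9.10 is `p` inert or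
ramified in `K`; Skinner 2020 is `p ≥ 5` good ordinary; Kriz–Li 2019 Thm. 2.9 is a congruence whose PROOF contains
the value identity at any `p` but does not state it).

HONEST FRAMING: every theorem here is an implication or a logical equivalence between typed statements; (VC₃),
(VN₃) and THEOREM C typed are NOT discharged, NOT kernel theorems and NOT Literature facts; nothing is booked; no
node, label or census count moves (T7); O2 stays OPEN; BSD(E,3) is proved for no class by this file.

References: [Castella2018] Camb. J. Math. 6 (2018) = arXiv:1704.06608, Thm. 3.1–3.2 (pp. 8–9); [CastellaHsieh2018]
Math. Ann. 370, §3.3; [BertoliniDarmonPrasanna2013] Duke Math. J. 162, Assumption 5.12, Thm. 5.13; [Castella2018Exceptional]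
J. Inst. Math. Jussieu 17 (2018), Thms. 2.10–2.11; cell memo PROOF-BDP v1.8 §20 (THEOREM C), v1.9 §21 (THEOREM C♯).
-/

noncomputable section

open scoped Classical Topology

open Filter WeierstrassCurve NumberField IsDedekindDomain Field PowerSeries
  Literature.NumberTheory.EllipticCurves Literature.NumberTheory.EllipticCurves.ModularForms
  Literature.NumberTheory.EllipticCurves.Rank1Residual
  Literature.NumberTheory.GaloisRepresentations Literature.NumberTheory.GaloisCohomology
  Summit.BirchSwinnertonDyer.Rank1Residual Summit.BirchSwinnertonDyer.Rank1Residual.X11b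
  Summit.BirchSwinnertonDyer.Rank1Residual.X11b.AcSelmer
  Summit.BirchSwinnertonDyer.Rank1Residual.X11b.CongruenceLimit
  Summit.BirchSwinnertonDyer.Rank1Residual.X11b.Halves
  Summit.BirchSwinnertonDyer.Rank1Residual.X11b.Three
  Summit.BirchSwinnertonDyer.BirchSwinnertonDyer.Theses.ClassRecordThree

namespace Summit.BirchSwinnertonDyer.BirchSwinnertonDyer.Theorems

/-! ## §1 The crux ⟸ THEOREM C typed (by name) -/

/-- **Crux `ValueContinuityAtThree` (19493) ⟸ THEOREM C typed for every curve** — g0's hypothesis `hC` (= the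
frame-value statement `h12` of `Three.bdpValueAt₃_of_frameValue` at every curve), through g2's
`valueContinuity₃_classwide_of_classicalFrameValue`, concluding the ROUTE DECL literally. CONDITIONAL on THEOREM C
typed (memo THEOREM C, PROOF-BDP §20; not kernel, not print at `3 ∥ N`).
[cite: Castella2018, Thm. 3.1–3.2 (arXiv:1704.06608 pp. 8–9) (frame and value shapes only; nothing asserted at p = 3)] -/
theorem classRecordThree_valueContinuityAtThree_of_classicalFrameValue
    (hC : ∀ (W : WeierstrassCurve ℚ) [W.IsElliptic] [W.IsGloballyMinimal],
      ∀ (N : ℕ) [NeZero N] (K : Type) [Field K] [NumberField K] (Dt : ModularParametrizationData W N)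
      (H : HeegnerDatum N (NumberField.discr K)) (ι : K →+* ℂ) (P : (W.baseChange K).toAffine.Point),
      ClassX11b W 3 → Surj W 3 → W.conductorNorm ℤ = N → IsImaginaryQuadratic K →
      Odd (NumberField.discr K) → SatisfiesHeegnerHypothesis N K →
      (W.quadraticTwist (NumberField.discr K : ℚ)).entireLFunction 1 ≠ 0 →
      WeierstrassCurve.Affine.Point.map ι.toRatAlgHom P = heegnerPointComplex Dt H →
      ¬ (3 : ℤ) ∣ Dt.c → ¬ IsOfFinAddOrder P →
      ∀ (κ : ZpExtension K 3), κ.IsAnticyclotomic →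
        ∀ (γ : Field.absoluteGaloisGroup K) [Fact (κ.IsTopGenerator γ)]
          (𝔭 : HeightOneSpectrum (𝓞 K)) (h𝔭 : ((3 : ℕ) : 𝓞 K) ∈ 𝔭.asIdeal)
          (he : 𝔭.asIdeal.ramificationIdx (𝓞 ℚ) = 1) (hf : 𝔭.asIdeal.inertiaDeg (𝓞 ℚ) = 1),
          ∀ (f : CuspForm (CongruenceSubgroup.Gamma0 N) 2), IsNewformOf W f →
            ∀ (ι' : PadicAlgCl 3 ≃+* ℂ), InducesPrime ι' 𝔭 →
              ∃ (ΩK : ℂ) (Ωp : (unrIntegers 3)ˣ) (L : UnrSeries 3),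
                ΩK ≠ 0 ∧ IsBDPLFunction ι' 𝔭 κ γ f ΩK ((Ωp : unrIntegers 3) : ℂ_[3]) L ∧
                ∃ u : (unrIntegers 3)ˣ, L.HasValueAt 0 (((u : unrIntegers 3) : ℂ_[3]) *
                  (algebraMap ℚ_[3] ℂ_[3] (((1 : ℚ_[3]) - ((W.LFunction 3 : ℤ) : ℚ_[3]) * (3 : ℚ_[3])⁻¹) *
                    logOmega W 3 (embAt K 3 𝔭 h𝔭 he hf) P)) ^ 2)) :
    ValueContinuityAtThree :=
  valueContinuity₃_classwide_of_classicalFrameValue hC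

/-! ## §2 The crux ⟸ (VN₃) ∧ frames at every `ι'` -/

/-- **Crux `ValueContinuityAtThree` ⟸ NORM continuity at `𝟙` for every curve ∧ frame existence at every datum and
every `ι'`**: compose g3's `classicalFrameValue₃_of_normContinuity_of_frames` ((VN₃) ∧ frames ⟹ THEOREM C typed, one
curve) with g2's `valueContinuity₃_of_classicalFrameValue`. With §3 (crux ⟹ (VN₃)): modulo the ∀-`ι'` frame
existence the crux IS norm continuity at `𝟙`. CONDITIONAL on both hypotheses (neither in print at `3 ∥ N`).
[cite: Castella2018, Thm. 3.1–3.2 (arXiv:1704.06608 pp. 8–9) (display and frame shapes only; nothing asserted at p = 3)] -/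
theorem classRecordThree_valueContinuityAtThree_of_normContinuity_of_frames
    (hVN : ∀ (W : WeierstrassCurve ℚ) [W.IsElliptic] [W.IsGloballyMinimal],
      ∀ (N : ℕ) [NeZero N] (K : Type) [Field K] [NumberField K] (Dt : ModularParametrizationData W N)
      (H : HeegnerDatum N (NumberField.discr K)) (ι : K →+* ℂ) (P : (W.baseChange K).toAffine.Point),
      ClassX11b W 3 → Surj W 3 → W.conductorNorm ℤ = N → IsImaginaryQuadratic K →
      Odd (NumberField.discr K) → SatisfiesHeegnerHypothesis N K →
      (W.quadraticTwist (NumberField.discr K : ℚ)).entireLFunction 1 ≠ 0 →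
      WeierstrassCurve.Affine.Point.map ι.toRatAlgHom P = heegnerPointComplex Dt H →
      ¬ (3 : ℤ) ∣ Dt.c → ¬ IsOfFinAddOrder P →
      ∀ (κ : ZpExtension K 3), κ.IsAnticyclotomic →
        ∀ (γ : Field.absoluteGaloisGroup K) [Fact (κ.IsTopGenerator γ)]
          (𝔭 : HeightOneSpectrum (𝓞 K)) (h𝔭 : ((3 : ℕ) : 𝓞 K) ∈ 𝔭.asIdeal)
          (he : 𝔭.asIdeal.ramificationIdx (𝓞 ℚ) = 1) (hf : 𝔭.asIdeal.inertiaDeg (𝓞 ℚ) = 1),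
          ∀ (f : CuspForm (CongruenceSubgroup.Gamma0 N) 2), IsNewformOf W f →
            ∀ (ι' : PadicAlgCl 3 ≃+* ℂ), InducesPrime ι' 𝔭 →
              ∃ (ΩK : ℂ) (Ωp : ℂ_[3]), ΩK ≠ 0 ∧ Ωp ≠ 0 ∧
                ∀ (φ : ℕ → HeckeCharacter K) (n : ℕ → ℕ) (r : ℕ → FramedGaloisRep K (PadicAlgCl 3) 1),
                  (∀ k, 0 < n k) → (∀ k (v : HeightOneSpectrum (𝓞 K)), (φ k).IsUnramifiedAt v) →
                  (∀ k, (φ k).HasInfinityType (fun _ ↦ (n k : ℤ)) (fun _ ↦ -(n k : ℤ))) →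
                  (∀ k, IsPAdicAvatarOf ι' (φ k) (r k)) → (∀ k, FactorsThroughZp κ (r k)) →
                  Tendsto (fun k ↦ avatarValueAt (r k) γ) atTop (𝓝 1) →
                  Tendsto (fun k ↦ ‖((ι'.symm (bdpInterpolationValue 3 f 𝔭 (φ k) (n k) ΩK) :
                    PadicAlgCl 3) : ℂ_[3]) * Ωp ^ (4 * n k)‖) atTop
                    (𝓝 (‖algebraMap ℚ_[3] ℂ_[3] (((1 : ℚ_[3]) - ((W.LFunction 3 : ℤ) : ℚ_[3]) *
                        (3 : ℚ_[3])⁻¹) * logOmega W 3 (embAt K 3 𝔭 h𝔭 he hf) P)‖ ^ 2)))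
    (hF : ∀ (W : WeierstrassCurve ℚ) [W.IsElliptic] [W.IsGloballyMinimal],
      ∀ (N : ℕ) [NeZero N] (K : Type) [Field K] [NumberField K] (Dt : ModularParametrizationData W N)
      (H : HeegnerDatum N (NumberField.discr K)) (ι : K →+* ℂ) (P : (W.baseChange K).toAffine.Point),
      ClassX11b W 3 → Surj W 3 → W.conductorNorm ℤ = N → IsImaginaryQuadratic K →
      Odd (NumberField.discr K) → SatisfiesHeegnerHypothesis N K →
      (W.quadraticTwist (NumberField.discr K : ℚ)).entireLFunction 1 ≠ 0 →
      WeierstrassCurve.Affine.Point.map ι.toRatAlgHom P = heegnerPointComplex Dt H →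
      ¬ (3 : ℤ) ∣ Dt.c → ¬ IsOfFinAddOrder P →
      ∀ (κ : ZpExtension K 3), κ.IsAnticyclotomic →
        ∀ (γ : Field.absoluteGaloisGroup K) [Fact (κ.IsTopGenerator γ)]
          (𝔭 : HeightOneSpectrum (𝓞 K)) (h𝔭 : ((3 : ℕ) : 𝓞 K) ∈ 𝔭.asIdeal)
          (he : 𝔭.asIdeal.ramificationIdx (𝓞 ℚ) = 1) (hf : 𝔭.asIdeal.inertiaDeg (𝓞 ℚ) = 1),
          ∀ (f : CuspForm (CongruenceSubgroup.Gamma0 N) 2), IsNewformOf W f →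
            ∀ (ι' : PadicAlgCl 3 ≃+* ℂ), InducesPrime ι' 𝔭 →
              ∃ (ΩK : ℂ) (Ωp : (unrIntegers 3)ˣ) (L : UnrSeries 3),
                ΩK ≠ 0 ∧ IsBDPLFunction ι' 𝔭 κ γ f ΩK ((Ωp : unrIntegers 3) : ℂ_[3]) L) :
    ValueContinuityAtThree :=
  fun W _ _ ↦ valueContinuity₃_of_classicalFrameValue
    (classicalFrameValue₃_of_normContinuity_of_frames (hVN W) (hF W))

/-! ## §3 What the crux gives by name: (VN₃), `Three.BDPValueAt₃`, the H2 leaf -/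

/-- **Crux ⟹ (VN₃) for every curve** (take norms: g3's `normContinuity₃_of_valueContinuity` at each curve).
[cite: Castella2018, Thm. 3.1 (arXiv:1704.06608 p. 9) (display shape only)] -/
theorem normContinuity₃_classwide_of_classRecordThree_valueContinuityAtThree (h : ValueContinuityAtThree) :
    ∀ (W : WeierstrassCurve ℚ) [W.IsElliptic] [W.IsGloballyMinimal],
    ∀ (N : ℕ) [NeZero N] (K : Type) [Field K] [NumberField K] (Dt : ModularParametrizationData W N)
    (H : HeegnerDatum N (NumberField.discr K)) (ι : K →+* ℂ) (P : (W.baseChange K).toAffine.Point),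
    ClassX11b W 3 → Surj W 3 → W.conductorNorm ℤ = N → IsImaginaryQuadratic K →
    Odd (NumberField.discr K) → SatisfiesHeegnerHypothesis N K →
    (W.quadraticTwist (NumberField.discr K : ℚ)).entireLFunction 1 ≠ 0 →
    WeierstrassCurve.Affine.Point.map ι.toRatAlgHom P = heegnerPointComplex Dt H →
    ¬ (3 : ℤ) ∣ Dt.c → ¬ IsOfFinAddOrder P →
    ∀ (κ : ZpExtension K 3), κ.IsAnticyclotomic →
      ∀ (γ : Field.absoluteGaloisGroup K) [Fact (κ.IsTopGenerator γ)]
        (𝔭 : HeightOneSpectrum (𝓞 K)) (h𝔭 : ((3 : ℕ) : 𝓞 K) ∈ 𝔭.asIdeal)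
        (he : 𝔭.asIdeal.ramificationIdx (𝓞 ℚ) = 1) (hf : 𝔭.asIdeal.inertiaDeg (𝓞 ℚ) = 1),
        ∀ (f : CuspForm (CongruenceSubgroup.Gamma0 N) 2), IsNewformOf W f →
          ∀ (ι' : PadicAlgCl 3 ≃+* ℂ), InducesPrime ι' 𝔭 →
            ∃ (ΩK : ℂ) (Ωp : ℂ_[3]), ΩK ≠ 0 ∧ Ωp ≠ 0 ∧
              ∀ (φ : ℕ → HeckeCharacter K) (n : ℕ → ℕ) (r : ℕ → FramedGaloisRep K (PadicAlgCl 3) 1),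
                (∀ k, 0 < n k) → (∀ k (v : HeightOneSpectrum (𝓞 K)), (φ k).IsUnramifiedAt v) →
                (∀ k, (φ k).HasInfinityType (fun _ ↦ (n k : ℤ)) (fun _ ↦ -(n k : ℤ))) →
                (∀ k, IsPAdicAvatarOf ι' (φ k) (r k)) → (∀ k, FactorsThroughZp κ (r k)) →
                Tendsto (fun k ↦ avatarValueAt (r k) γ) atTop (𝓝 1) →
                Tendsto (fun k ↦ ‖((ι'.symm (bdpInterpolationValue 3 f 𝔭 (φ k) (n k) ΩK) :
                  PadicAlgCl 3) : ℂ_[3]) * Ωp ^ (4 * n k)‖) atTop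
                  (𝓝 (‖algebraMap ℚ_[3] ℂ_[3] (((1 : ℚ_[3]) - ((W.LFunction 3 : ℤ) : ℚ_[3]) *
                      (3 : ℚ_[3])⁻¹) * logOmega W 3 (embAt K 3 𝔭 h𝔭 he hf) P)‖ ^ 2)) :=
  fun W _ _ ↦ normContinuity₃_of_valueContinuity (h W)

/-- **Crux ⟹ the ∀-frame H2 of record `Three.BDPValueAt₃ W` for every curve** (g2's `bdpValueAt₃_of_valueContinuity`).
[cite: Castella2018, Thm. 3.2 (arXiv:1704.06608 p. 9) (value shape only; nothing asserted at p = 3)] -/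
theorem bdpValueAt₃_of_classRecordThree_valueContinuityAtThree (h : ValueContinuityAtThree)
    (W : WeierstrassCurve ℚ) [W.IsElliptic] [W.IsGloballyMinimal] : BDPValueAt₃ W :=
  bdpValueAt₃_of_valueContinuity (h W)

/-- **Crux 19493 ⟹ the aside leaf `BDPValueLeafAtThree` (item 19406)**, by name (g3's
`classRecordThree_bdpValueLeafAtThree_of_valueContinuity`). [cite: Castella2018, Thm. 3.2 (arXiv:1704.06608 p. 9) (value shape only)] -/
theorem classRecordThree_bdpValueLeafAtThree_of_valueContinuityAtThree (h : ValueContinuityAtThree) :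
    BDPValueLeafAtThree :=
  classRecordThree_bdpValueLeafAtThree_of_valueContinuity h

/-! ## §4 The registered BC3 stubs (planner g24, 2026-08-26T09:00Z): each ⟸ THEOREM C typed on its sign -/

/-- **Registered stub (a) `stub_vc3_split` ⟸ THEOREM C typed on the curves SPLIT multiplicative at 3** (`a₃ = +1`,
factor `1 − 3⁻¹ = 2/3`): the conclusion is the stub's registered signature VERBATIM; the hypothesis is g0's `hC`
with the extra binder `W.HasSplitMultiplicativeReductionAtPrime 3 →`. CONDITIONAL (memo THEOREM C covers both signs).
[cite: Castella2018, Thm. 3.1–3.2 (arXiv:1704.06608 pp. 8–9) (shapes only; nothing asserted at p = 3)] -/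
theorem classRecordThree_stub_vc3_split_of_classicalFrameValue
    (hC : ∀ (W : WeierstrassCurve ℚ) [W.IsElliptic] [W.IsGloballyMinimal],
      W.HasSplitMultiplicativeReductionAtPrime 3 →
      ∀ (N : ℕ) [NeZero N] (K : Type) [Field K] [NumberField K] (Dt : ModularParametrizationData W N)
      (H : HeegnerDatum N (NumberField.discr K)) (ι : K →+* ℂ) (P : (W.baseChange K).toAffine.Point),
      ClassX11b W 3 → Surj W 3 → W.conductorNorm ℤ = N → IsImaginaryQuadratic K →
      Odd (NumberField.discr K) → SatisfiesHeegnerHypothesis N K →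
      (W.quadraticTwist (NumberField.discr K : ℚ)).entireLFunction 1 ≠ 0 →
      WeierstrassCurve.Affine.Point.map ι.toRatAlgHom P = heegnerPointComplex Dt H →
      ¬ (3 : ℤ) ∣ Dt.c → ¬ IsOfFinAddOrder P →
      ∀ (κ : ZpExtension K 3), κ.IsAnticyclotomic →
        ∀ (γ : Field.absoluteGaloisGroup K) [Fact (κ.IsTopGenerator γ)]
          (𝔭 : HeightOneSpectrum (𝓞 K)) (h𝔭 : ((3 : ℕ) : 𝓞 K) ∈ 𝔭.asIdeal)
          (he : 𝔭.asIdeal.ramificationIdx (𝓞 ℚ) = 1) (hf : 𝔭.asIdeal.inertiaDeg (𝓞 ℚ) = 1),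
          ∀ (f : CuspForm (CongruenceSubgroup.Gamma0 N) 2), IsNewformOf W f →
            ∀ (ι' : PadicAlgCl 3 ≃+* ℂ), InducesPrime ι' 𝔭 →
              ∃ (ΩK : ℂ) (Ωp : (unrIntegers 3)ˣ) (L : UnrSeries 3),
                ΩK ≠ 0 ∧ IsBDPLFunction ι' 𝔭 κ γ f ΩK ((Ωp : unrIntegers 3) : ℂ_[3]) L ∧
                ∃ u : (unrIntegers 3)ˣ, L.HasValueAt 0 (((u : unrIntegers 3) : ℂ_[3]) *
                  (algebraMap ℚ_[3] ℂ_[3] (((1 : ℚ_[3]) - ((W.LFunction 3 : ℤ) : ℚ_[3]) * (3 : ℚ_[3])⁻¹) *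
                    logOmega W 3 (embAt K 3 𝔭 h𝔭 he hf) P)) ^ 2)) :
    ∀ (W : WeierstrassCurve ℚ) [W.IsElliptic] [W.IsGloballyMinimal],
    ∀ (N : ℕ) [NeZero N] (K : Type) [Field K] [NumberField K] (Dt : ModularParametrizationData W N)
    (H : HeegnerDatum N (NumberField.discr K)) (ι : K →+* ℂ) (P : (W.baseChange K).toAffine.Point),
    W.HasSplitMultiplicativeReductionAtPrime 3 → ClassX11b W 3 → Surj W 3 → W.conductorNorm ℤ = N → IsImaginaryQuadratic K →
    Odd (NumberField.discr K) → SatisfiesHeegnerHypothesis N K →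
    (W.quadraticTwist (NumberField.discr K : ℚ)).entireLFunction 1 ≠ 0 →
    WeierstrassCurve.Affine.Point.map ι.toRatAlgHom P = heegnerPointComplex Dt H →
    ¬ (3 : ℤ) ∣ Dt.c → ¬ IsOfFinAddOrder P →
    ∀ (κ : ZpExtension K 3), κ.IsAnticyclotomic →
      ∀ (γ : Field.absoluteGaloisGroup K) [Fact (κ.IsTopGenerator γ)]
        (𝔭 : HeightOneSpectrum (𝓞 K)) (h𝔭 : ((3 : ℕ) : 𝓞 K) ∈ 𝔭.asIdeal)
        (he : 𝔭.asIdeal.ramificationIdx (𝓞 ℚ) = 1) (hf : 𝔭.asIdeal.inertiaDeg (𝓞 ℚ) = 1),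
        ∀ (f : CuspForm (CongruenceSubgroup.Gamma0 N) 2), IsNewformOf W f →
          ∀ (ι' : PadicAlgCl 3 ≃+* ℂ), InducesPrime ι' 𝔭 →
            ∃ (ΩK : ℂ) (Ωp : ℂ_[3]) (u : (unrIntegers 3)ˣ), ΩK ≠ 0 ∧ Ωp ≠ 0 ∧
              ∀ (φ : ℕ → HeckeCharacter K) (n : ℕ → ℕ) (r : ℕ → FramedGaloisRep K (PadicAlgCl 3) 1),
                (∀ k, 0 < n k) → (∀ k (v : HeightOneSpectrum (𝓞 K)), (φ k).IsUnramifiedAt v) →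
                (∀ k, (φ k).HasInfinityType (fun _ ↦ (n k : ℤ)) (fun _ ↦ -(n k : ℤ))) →
                (∀ k, IsPAdicAvatarOf ι' (φ k) (r k)) → (∀ k, FactorsThroughZp κ (r k)) →
                Tendsto (fun k ↦ avatarValueAt (r k) γ) atTop (𝓝 1) →
                Tendsto (fun k ↦ ((ι'.symm (bdpInterpolationValue 3 f 𝔭 (φ k) (n k) ΩK) :
                  PadicAlgCl 3) : ℂ_[3]) * Ωp ^ (4 * n k)) atTop
                  (𝓝 (((u : unrIntegers 3) : ℂ_[3]) *
                    (algebraMap ℚ_[3] ℂ_[3] (((1 : ℚ_[3]) - ((W.LFunction 3 : ℤ) : ℚ_[3]) *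
                      (3 : ℚ_[3])⁻¹) * logOmega W 3 (embAt K 3 𝔭 h𝔭 he hf) P)) ^ 2)) := by
  intro W _ _ N _ K _ _ Dt H ι P hsplit
  exact valueContinuity₃_of_classicalFrameValue (hC W hsplit) N K Dt H ι P

/-- **Registered stub (b) `stub_vc3_nonsplit` ⟸ THEOREM C typed on the curves NON-SPLIT multiplicative at 3**
(`a₃ = −1`, factor `1 + 3⁻¹ = 4/3`): conclusion = the stub's registered signature VERBATIM. CONDITIONAL.
[cite: Castella2018, Thm. 3.1–3.2 (arXiv:1704.06608 pp. 8–9) (shapes only; nothing asserted at p = 3)] -/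
theorem classRecordThree_stub_vc3_nonsplit_of_classicalFrameValue
    (hC : ∀ (W : WeierstrassCurve ℚ) [W.IsElliptic] [W.IsGloballyMinimal],
      ¬ W.HasSplitMultiplicativeReductionAtPrime 3 →
      ∀ (N : ℕ) [NeZero N] (K : Type) [Field K] [NumberField K] (Dt : ModularParametrizationData W N)
      (H : HeegnerDatum N (NumberField.discr K)) (ι : K →+* ℂ) (P : (W.baseChange K).toAffine.Point),
      ClassX11b W 3 → Surj W 3 → W.conductorNorm ℤ = N → IsImaginaryQuadratic K →
      Odd (NumberField.discr K) → SatisfiesHeegnerHypothesis N K →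
      (W.quadraticTwist (NumberField.discr K : ℚ)).entireLFunction 1 ≠ 0 →
      WeierstrassCurve.Affine.Point.map ι.toRatAlgHom P = heegnerPointComplex Dt H →
      ¬ (3 : ℤ) ∣ Dt.c → ¬ IsOfFinAddOrder P →
      ∀ (κ : ZpExtension K 3), κ.IsAnticyclotomic →
        ∀ (γ : Field.absoluteGaloisGroup K) [Fact (κ.IsTopGenerator γ)]
          (𝔭 : HeightOneSpectrum (𝓞 K)) (h𝔭 : ((3 : ℕ) : 𝓞 K) ∈ 𝔭.asIdeal)
          (he : 𝔭.asIdeal.ramificationIdx (𝓞 ℚ) = 1) (hf : 𝔭.asIdeal.inertiaDeg (𝓞 ℚ) = 1),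
          ∀ (f : CuspForm (CongruenceSubgroup.Gamma0 N) 2), IsNewformOf W f →
            ∀ (ι' : PadicAlgCl 3 ≃+* ℂ), InducesPrime ι' 𝔭 →
              ∃ (ΩK : ℂ) (Ωp : (unrIntegers 3)ˣ) (L : UnrSeries 3),
                ΩK ≠ 0 ∧ IsBDPLFunction ι' 𝔭 κ γ f ΩK ((Ωp : unrIntegers 3) : ℂ_[3]) L ∧
                ∃ u : (unrIntegers 3)ˣ, L.HasValueAt 0 (((u : unrIntegers 3) : ℂ_[3]) *
                  (algebraMap ℚ_[3] ℂ_[3] (((1 : ℚ_[3]) - ((W.LFunction 3 : ℤ) : ℚ_[3]) * (3 : ℚ_[3])⁻¹) *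
                    logOmega W 3 (embAt K 3 𝔭 h𝔭 he hf) P)) ^ 2)) :
    ∀ (W : WeierstrassCurve ℚ) [W.IsElliptic] [W.IsGloballyMinimal],
    ∀ (N : ℕ) [NeZero N] (K : Type) [Field K] [NumberField K] (Dt : ModularParametrizationData W N)
    (H : HeegnerDatum N (NumberField.discr K)) (ι : K →+* ℂ) (P : (W.baseChange K).toAffine.Point),
    ¬ W.HasSplitMultiplicativeReductionAtPrime 3 → ClassX11b W 3 → Surj W 3 → W.conductorNorm ℤ = N → IsImaginaryQuadratic K →
    Odd (NumberField.discr K) → SatisfiesHeegnerHypothesis N K →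
    (W.quadraticTwist (NumberField.discr K : ℚ)).entireLFunction 1 ≠ 0 →
    WeierstrassCurve.Affine.Point.map ι.toRatAlgHom P = heegnerPointComplex Dt H →
    ¬ (3 : ℤ) ∣ Dt.c → ¬ IsOfFinAddOrder P →
    ∀ (κ : ZpExtension K 3), κ.IsAnticyclotomic →
      ∀ (γ : Field.absoluteGaloisGroup K) [Fact (κ.IsTopGenerator γ)]
        (𝔭 : HeightOneSpectrum (𝓞 K)) (h𝔭 : ((3 : ℕ) : 𝓞 K) ∈ 𝔭.asIdeal)
        (he : 𝔭.asIdeal.ramificationIdx (𝓞 ℚ) = 1) (hf : 𝔭.asIdeal.inertiaDeg (𝓞 ℚ) = 1),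
        ∀ (f : CuspForm (CongruenceSubgroup.Gamma0 N) 2), IsNewformOf W f →
          ∀ (ι' : PadicAlgCl 3 ≃+* ℂ), InducesPrime ι' 𝔭 →
            ∃ (ΩK : ℂ) (Ωp : ℂ_[3]) (u : (unrIntegers 3)ˣ), ΩK ≠ 0 ∧ Ωp ≠ 0 ∧
              ∀ (φ : ℕ → HeckeCharacter K) (n : ℕ → ℕ) (r : ℕ → FramedGaloisRep K (PadicAlgCl 3) 1),
                (∀ k, 0 < n k) → (∀ k (v : HeightOneSpectrum (𝓞 K)), (φ k).IsUnramifiedAt v) →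
                (∀ k, (φ k).HasInfinityType (fun _ ↦ (n k : ℤ)) (fun _ ↦ -(n k : ℤ))) →
                (∀ k, IsPAdicAvatarOf ι' (φ k) (r k)) → (∀ k, FactorsThroughZp κ (r k)) →
                Tendsto (fun k ↦ avatarValueAt (r k) γ) atTop (𝓝 1) →
                Tendsto (fun k ↦ ((ι'.symm (bdpInterpolationValue 3 f 𝔭 (φ k) (n k) ΩK) :
                  PadicAlgCl 3) : ℂ_[3]) * Ωp ^ (4 * n k)) atTop
                  (𝓝 (((u : unrIntegers 3) : ℂ_[3]) *
                    (algebraMap ℚ_[3] ℂ_[3] (((1 : ℚ_[3]) - ((W.LFunction 3 : ℤ) : ℚ_[3]) *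
                      (3 : ℚ_[3])⁻¹) * logOmega W 3 (embAt K 3 𝔭 h𝔭 he hf) P)) ^ 2)) := by
  intro W _ _ N _ K _ _ Dt H ι P hns
  exact valueContinuity₃_of_classicalFrameValue (hC W hns) N K Dt H ι P

/-! ## §5 The sign split is lossless: crux ⟺ stub (a) ∧ stub (b) -/

/-- **Crux `ValueContinuityAtThree` ⟺ `stub_vc3_split` ∧ `stub_vc3_nonsplit`** (their registered signatures
verbatim): ⟹ drop the sign binder; ⟸ is the planner's composition `ValueContinuityAtThree_of` (case split on the
reduction sign at 3). So the BC3 skeleton of 19493 decomposes the crux without loss and without gain: each stub is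
the crux on one sign. [folklore] -/
theorem classRecordThree_valueContinuityAtThree_iff_stubs :
    ValueContinuityAtThree ↔
      ((∀ (W : WeierstrassCurve ℚ) [W.IsElliptic] [W.IsGloballyMinimal],
        ∀ (N : ℕ) [NeZero N] (K : Type) [Field K] [NumberField K] (Dt : ModularParametrizationData W N)
        (H : HeegnerDatum N (NumberField.discr K)) (ι : K →+* ℂ) (P : (W.baseChange K).toAffine.Point),
        W.HasSplitMultiplicativeReductionAtPrime 3 → ClassX11b W 3 → Surj W 3 → W.conductorNorm ℤ = N → IsImaginaryQuadratic K →
        Odd (NumberField.discr K) → SatisfiesHeegnerHypothesis N K →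
        (W.quadraticTwist (NumberField.discr K : ℚ)).entireLFunction 1 ≠ 0 →
        WeierstrassCurve.Affine.Point.map ι.toRatAlgHom P = heegnerPointComplex Dt H →
        ¬ (3 : ℤ) ∣ Dt.c → ¬ IsOfFinAddOrder P →
        ∀ (κ : ZpExtension K 3), κ.IsAnticyclotomic →
          ∀ (γ : Field.absoluteGaloisGroup K) [Fact (κ.IsTopGenerator γ)]
            (𝔭 : HeightOneSpectrum (𝓞 K)) (h𝔭 : ((3 : ℕ) : 𝓞 K) ∈ 𝔭.asIdeal)
            (he : 𝔭.asIdeal.ramificationIdx (𝓞 ℚ) = 1) (hf : 𝔭.asIdeal.inertiaDeg (𝓞 ℚ) = 1),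
            ∀ (f : CuspForm (CongruenceSubgroup.Gamma0 N) 2), IsNewformOf W f →
              ∀ (ι' : PadicAlgCl 3 ≃+* ℂ), InducesPrime ι' 𝔭 →
                ∃ (ΩK : ℂ) (Ωp : ℂ_[3]) (u : (unrIntegers 3)ˣ), ΩK ≠ 0 ∧ Ωp ≠ 0 ∧
                  ∀ (φ : ℕ → HeckeCharacter K) (n : ℕ → ℕ) (r : ℕ → FramedGaloisRep K (PadicAlgCl 3) 1),
                    (∀ k, 0 < n k) → (∀ k (v : HeightOneSpectrum (𝓞 K)), (φ k).IsUnramifiedAt v) →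
                    (∀ k, (φ k).HasInfinityType (fun _ ↦ (n k : ℤ)) (fun _ ↦ -(n k : ℤ))) →
                    (∀ k, IsPAdicAvatarOf ι' (φ k) (r k)) → (∀ k, FactorsThroughZp κ (r k)) →
                    Tendsto (fun k ↦ avatarValueAt (r k) γ) atTop (𝓝 1) →
                    Tendsto (fun k ↦ ((ι'.symm (bdpInterpolationValue 3 f 𝔭 (φ k) (n k) ΩK) :
                      PadicAlgCl 3) : ℂ_[3]) * Ωp ^ (4 * n k)) atTop
                      (𝓝 (((u : unrIntegers 3) : ℂ_[3]) *
                        (algebraMap ℚ_[3] ℂ_[3] (((1 : ℚ_[3]) - ((W.LFunction 3 : ℤ) : ℚ_[3]) *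
                          (3 : ℚ_[3])⁻¹) * logOmega W 3 (embAt K 3 𝔭 h𝔭 he hf) P)) ^ 2))) ∧
       (∀ (W : WeierstrassCurve ℚ) [W.IsElliptic] [W.IsGloballyMinimal],
        ∀ (N : ℕ) [NeZero N] (K : Type) [Field K] [NumberField K] (Dt : ModularParametrizationData W N)
        (H : HeegnerDatum N (NumberField.discr K)) (ι : K →+* ℂ) (P : (W.baseChange K).toAffine.Point),
        ¬ W.HasSplitMultiplicativeReductionAtPrime 3 → ClassX11b W 3 → Surj W 3 → W.conductorNorm ℤ = N → IsImaginaryQuadratic K →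
        Odd (NumberField.discr K) → SatisfiesHeegnerHypothesis N K →
        (W.quadraticTwist (NumberField.discr K : ℚ)).entireLFunction 1 ≠ 0 →
        WeierstrassCurve.Affine.Point.map ι.toRatAlgHom P = heegnerPointComplex Dt H →
        ¬ (3 : ℤ) ∣ Dt.c → ¬ IsOfFinAddOrder P →
        ∀ (κ : ZpExtension K 3), κ.IsAnticyclotomic →
          ∀ (γ : Field.absoluteGaloisGroup K) [Fact (κ.IsTopGenerator γ)]
            (𝔭 : HeightOneSpectrum (𝓞 K)) (h𝔭 : ((3 : ℕ) : 𝓞 K) ∈ 𝔭.asIdeal)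
            (he : 𝔭.asIdeal.ramificationIdx (𝓞 ℚ) = 1) (hf : 𝔭.asIdeal.inertiaDeg (𝓞 ℚ) = 1),
            ∀ (f : CuspForm (CongruenceSubgroup.Gamma0 N) 2), IsNewformOf W f →
              ∀ (ι' : PadicAlgCl 3 ≃+* ℂ), InducesPrime ι' 𝔭 →
                ∃ (ΩK : ℂ) (Ωp : ℂ_[3]) (u : (unrIntegers 3)ˣ), ΩK ≠ 0 ∧ Ωp ≠ 0 ∧
                  ∀ (φ : ℕ → HeckeCharacter K) (n : ℕ → ℕ) (r : ℕ → FramedGaloisRep K (PadicAlgCl 3) 1),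
                    (∀ k, 0 < n k) → (∀ k (v : HeightOneSpectrum (𝓞 K)), (φ k).IsUnramifiedAt v) →
                    (∀ k, (φ k).HasInfinityType (fun _ ↦ (n k : ℤ)) (fun _ ↦ -(n k : ℤ))) →
                    (∀ k, IsPAdicAvatarOf ι' (φ k) (r k)) → (∀ k, FactorsThroughZp κ (r k)) →
                    Tendsto (fun k ↦ avatarValueAt (r k) γ) atTop (𝓝 1) →
                    Tendsto (fun k ↦ ((ι'.symm (bdpInterpolationValue 3 f 𝔭 (φ k) (n k) ΩK) :
                      PadicAlgCl 3) : ℂ_[3]) * Ωp ^ (4 * n k)) atTop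
                      (𝓝 (((u : unrIntegers 3) : ℂ_[3]) *
                        (algebraMap ℚ_[3] ℂ_[3] (((1 : ℚ_[3]) - ((W.LFunction 3 : ℤ) : ℚ_[3]) *
                          (3 : ℚ_[3])⁻¹) * logOmega W 3 (embAt K 3 𝔭 h𝔭 he hf) P)) ^ 2)))) := by
  refine ⟨fun h ↦ ⟨fun W _ _ N _ K _ _ Dt H ι P _ ↦ h W N K Dt H ι P,
    fun W _ _ N _ K _ _ Dt H ι P _ ↦ h W N K Dt H ι P⟩, fun h W _ _ N _ K _ _ Dt H ι P ↦ ?_⟩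
  by_cases hs : W.HasSplitMultiplicativeReductionAtPrime 3
  · exact h.1 W N K Dt H ι P hs
  · exact h.2 W N K Dt H ι P hs

end Summit.BirchSwinnertonDyer.BirchSwinnertonDyer.Theorems

end
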